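import Summits.BirchSwinnertonDyer.BirchSwinnertonDyer.Theorems.EisensteinPrimesTwoVariableCyclotomicUnitLine
import Literature.NumberTheory.GaloisRepresentations.CyclotomicTowerLocalIndex
import Literature.NumberTheory.IwasawaTheory.Greenberg2016.SelmerGroupStructure
import HarnessLib

/-!
# Route `EisensteinPrimes` (rung K5), crux 2 `GoodLatticeBDPValue`, line `halves` v5, stub
# `stub_noPseudoNull`, road (γ): the `σ`-SUPPLY — at every finite place of a quadratic field some
# `σ ∈ Γ_{K_v}` has non-trivial image in `Γ = Gal(K̃_∞/K) ≅ ℤ_p²`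
# (helper for stmt-BirchSwinnertonDyer-19032)

Cell `bsd-eis`, seat `bsd-eis-k5-c2` (gen 8); instance glue G-b of HOME/k5-c2-MEMO-8.md §3 = the
hypothesis `hsup` of the instance theorem
`GreenbergFullAtSelmer.twistDeformation_fullAtSelmer_isAlmostDivisible`
(`Theorems/EisensteinPrimesTwistDeformationFullAtSelmer.lean`), which feeds LOC_v⁽¹⁾ / LOC_v⁽²⁾ /
`corank H⁰(K_v, 𝐃) = 0` at the finite places through Greenberg 2010 Lemma 5.2.2
(`twistDeformation_LOC1/LOC2`, `hasCorank_localH0_twistDeformation_zero`). PRINT: [Greenberg2016Selmer]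
§4.3 p. 20 L26–30 "that hypothesis holds for any prime `η` which does not split completely in
`K_∞/K`"; for `K` imaginary quadratic and `K̃_∞` the `ℤ_p²`-extension NO finite prime splits
completely, because `K̃_∞ ⊇ K_∞^{cyc}` and no finite prime splits completely in the cyclotomic
`ℤ_p`-extension (Greenberg LNM 1716 §1: "`Gal((F_∞)_η/F_v) ≅ ℤ_p` for every nonarchimedean `v`").
KERNEL: the tree's `exists_cyclotomicCharacter_resGal_not_mem_torsion` (some `σ ∈ Γ_{K_v}` has
`χ_p(σ)` of infinite order — Frobenius at `v ∤ p`, wild inertia at `v ∣ p`), the PROVED existence of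
the cyclotomic `ℤ_p`-extension (`ZpExtension.exists_isCyclotomic_holds`, `ker κ^{cyc} = χ_p⁻¹(μ)`)
and the UNCONDITIONAL rank bound `ZpExtension.kerSubgroup_inf_le_kerSubgroup_of_surjective`
(`ker κ₁ ∩ ker κ₂ ≤ ker κ^{cyc}` for a surjective pair, `[K:ℚ] ≤ 2`), with
`surjective_of_isTopGeneratorPair` (k5-c2 g7). Theorems only; no named fact, no `sorry`. HONEST
FRAMING: closes nothing by itself (`--supports`). References: [Greenberg2016Selmer] §4.3 p. 20;
[GreenbergLNM1716] §1; [Greenberg2010] Lemma 5.2.2.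
-/

set_option autoImplicit false
set_option linter.dupNamespace false

noncomputable section

open scoped Classical
open NumberField IsDedekindDomain Field
open Literature.NumberTheory.EllipticCurves Literature.NumberTheory.GaloisRepresentations
  Summit.BirchSwinnertonDyer.BirchSwinnertonDyer.Theorems.IwasawaTwoVariable

namespace Summit.BirchSwinnertonDyer.BirchSwinnertonDyer.Theorems.GreenbergFullAtSelmer

variable (K : Type) [Field K] [NumberField K] (p : ℕ) [Fact p.Prime]

/-- **No finite prime of a field of degree `≤ 2` splits completely in the compositum of a surjective
pair of `ℤ_p`-extensions**: for `κ₁, κ₂ : Γ_K → ℤ_p` jointly onto `ℤ_p²` and any finite place `v`,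
some `σ ∈ Γ_{K_v}` has `κ₁(σ) ≠ 1` or `κ₂(σ) ≠ 1` — take `σ` with `χ_p(σ)` of infinite order
(Frobenius at `v ∤ p`, inertia at `v ∣ p`); it moves the cyclotomic `ℤ_p`-extension, which lies in
`K̃_∞ = K̄^{ker κ₁ ∩ ker κ₂}`. [cite: Greenberg2016Selmer, §4.3 p. 20 L26–30] [cite: GreenbergLNM1716, §1] -/
theorem exists_resGal_apply_ne_one_of_surjective (hK : Module.finrank ℚ K ≤ 2) {κ₁ κ₂ : ZpExtension K p}
    (hsurj : Function.Surjective fun σ : absoluteGaloisGroup K ↦ (κ₁ σ, κ₂ σ))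
    (v : HeightOneSpectrum (𝓞 K)) :
    ∃ σ : absoluteGaloisGroup (v.adicCompletion K),
      κ₁ (absGaloisRestrict K (v.adicCompletion K) σ) ≠ 1 ∨
        κ₂ (absGaloisRestrict K (v.adicCompletion K) σ) ≠ 1 := by
  obtain ⟨σ, hσ⟩ := exists_cyclotomicCharacter_resGal_not_mem_torsion K p v
  obtain ⟨κc, hκc⟩ := ZpExtension.exists_isCyclotomic_holds K p
    (GaloisRep.cyclotomicCharacter_range_infinite K p)
  have hle := ZpExtension.kerSubgroup_inf_le_kerSubgroup_of_surjective hK hsurj κc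
  refine ⟨σ, ?_⟩
  by_contra h
  simp only [not_or, not_not] at h
  have hmem : absGaloisRestrict K (v.adicCompletion K) σ ∈ κ₁.kerSubgroup ⊓ κ₂.kerSubgroup :=
    ⟨ZpExtension.mem_kerSubgroup.mpr h.1, ZpExtension.mem_kerSubgroup.mpr h.2⟩
  have hc : absGaloisRestrict K (v.adicCompletion K) σ ∈ κc.kerSubgroup := hle hmem
  rw [hκc, Subgroup.mem_comap] at hc
  exact hσ hc

/-- **The `σ`-supply of the instance theorem** (`hsup` of
`twistDeformation_fullAtSelmer_isAlmostDivisible`): for `K` imaginary quadratic (degree `2`), a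
generator pair `(κ₁, κ₂; γ₁, γ₂)` of the `ℤ_p²`-tower and EVERY finite `v`, some `σ ∈ Γ_{K_v}` has
`κ₁(σ) ≠ 1 ∨ κ₂(σ) ≠ 1` (stated on `Place.Completion (Sum.inr v) = K_v`).
[cite: Greenberg2016Selmer, §4.3 p. 20 L26–30] [cite: Greenberg2010, Lemma 5.2.2 (PDF p. 28)] -/
theorem exists_resGal_apply_ne_one_of_isTopGeneratorPair (hK : IsImaginaryQuadratic K)
    {κ₁ κ₂ : ZpExtension K p} {γ₁ γ₂ : absoluteGaloisGroup K}
    (hpair : ZpExtension.IsTopGeneratorPair κ₁ κ₂ γ₁ γ₂) (v : HeightOneSpectrum (𝓞 K)) :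
    ∃ σ : absoluteGaloisGroup (Place.Completion (Sum.inr v : Place K)),
      κ₁ (absGaloisRestrict K _ σ) ≠ 1 ∨ κ₂ (absGaloisRestrict K _ σ) ≠ 1 :=
  exists_resGal_apply_ne_one_of_surjective K p hK.1.le (surjective_of_isTopGeneratorPair hpair) v

end Summit.BirchSwinnertonDyer.BirchSwinnertonDyer.Theorems.GreenbergFullAtSelmer

end
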